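import Summits.ResolutionOfSingularities.ResolutionOfSingularities.Theses.RadicialJung
import Summits.ResolutionOfSingularities.ResolutionOfSingularities.Theorems.RadicialJungCleanModelsStubCleanOrNodalOfFormal
import Summits.ResolutionOfSingularities.ResolutionOfSingularities.Theorems.RadicialJungCleanModelsStubFormalFibreReducedStalk
import Summits.ResolutionOfSingularities.ResolutionOfSingularities.Theorems.RadicialJungCleanModelsLooseIffFormal
import Summits.ResolutionOfSingularities.ResolutionOfSingularities.Theorems.RadicialJungCleanModelsAlgebraizeDimTwoPrep
import HarnessLib

/-!
# Stub `stub_algebraizeDimTwo`, part 2/2: algebraizing the formal boundary in dimension `≤ 2`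
(crux stmt-ResolutionOfSingularities-15917, `RadicialJung.CleanModels`, line `Sketch` rev 8)

Route `ResolutionOfSingularities/RadicialJung`, crux item `CleanModels`, line `Sketch` (rev 8): the
ASSEMBLY of the dimension-2 Zariski descent. Let `W` be regular integral separated of finite type
over a field `k` of characteristic `p` with `dim W ≤ 2`, `g₀ ∈ K(W) ∖ K(W)^p`, and `π : V → W` a
proper birational regular model on which, at every closed point `v`, some non-trivial
representative `Σ_{j<p} c_j^p g₀^j` of the `K(W)^p`-line of `g₀` is FORMALLY loosely clean in
`Ô_{V,v}`. Then some proper birational regular `π' : V' → W` carries at every closed point a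
non-trivial representative which is formally clean WITH ALGEBRAIC BOUNDARY (or of formal regular
type):

* `dim V = dim W ≤ 2` (`π` is an alteration, `IsAlteration.topologicalKrullDim_eq`), so
  `dim 𝒪_{V,v} ≤ 2` (`ringKrullDim_stalk_le_two`) and the height-one primes of `𝒪_{V,v}` are
  analytically unramified (`stub_formalFibreReducedStalk`); hence at every closed point the formally
  clean representative is Zariski loosely clean or NODAL (`stub_cleanOrNodalOfFormal`);
* part 1 (`exists_looseCleanModel_of_looseOrNodal`, file `…AlgebraizeDimTwoPrep.lean`): blowing up
  the finitely many non-clean (nodal) closed points gives `ρ : V' → V`, proper birational with `V'`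
  regular, on which at every closed point some twist `h^p · x` (`h ∈ K(V)^×`) of a representative
  `x` is loosely clean;
* `π' = ρ ≫ π` is proper and birational (`IsBirational.comp`); reading `h = π^♯ e` in `K(W)` along
  the isomorphism `π^♯ : K(W) ≅ K(V)`
  (`RatFn.functionFieldMap_bijective_of_isIso_morphismRestrict`),
  `h^p · π^♯(Σ c_j^p g₀^j) = π^♯(Σ (e c_j)^p g₀^j)` is again a non-trivial representative, and
  Zariski loose cleanness is formal cleanness with algebraic boundary
  (`looseClean_iff_algebraizedFormalClean`).
-/

noncomputable section

set_option linter.dupNamespace false -- mandated namespace of this single-conjunct summit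

open CategoryTheory AlgebraicGeometry TopologicalSpace IsLocalRing
open Literature.AlgebraicGeometry.Resolution Literature.AlgebraicGeometry.Motives

namespace Summit.ResolutionOfSingularities.ResolutionOfSingularities.Theorems.RadicialJung.CleanModels

universe u

/-- STUB `stub_algebraizeDimTwo` (assembly of the dimension-2 Zariski descent) — **algebraizing
the formal boundary in dimension `≤ 2`.** If `W` is regular integral separated of finite type over
a field `k` of characteristic `p` with `dim W ≤ 2`, `g₀ ∈ K(W) ∖ K(W)^p`, and the proper birational
regular model `π : V → W` carries at every closed point a non-trivial representative
`Σ_{j<p} c_j^p g₀^j` which is formally loosely clean in `Ô_{V,v}`, then some proper birational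
regular `π' : V' → W` carries at every closed point `v'` a non-trivial representative which is
formally clean with ALGEBRAIC boundary (`ι s = û ∏ ι(t_i)^{a_i}` for a minimal generating system
`(t_i)` of `𝔪_{v'}` and a formal unit `û`) or of formal regular type (i)/(ii). Proof: formally
clean is Zariski clean or nodal at the closed points of the surface `V`
(`stub_cleanOrNodalOfFormal`, `stub_formalFibreReducedStalk`); blow up the finitely many nodal
non-clean closed points
(`exists_looseCleanModel_of_looseOrNodal`); pull the twist back to `K(W)` and conclude by
`looseClean_iff_algebraizedFormalClean`. -/
theorem stub_algebraizeDimTwo (p : ℕ) (hp : p.Prime) (k : Type) [Field k] [CharP k p]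
    (W : Scheme.{0}) [IsIntegral W] (f : W ⟶ Spec (.of k)) [IsSeparated f]
    [LocallyOfFiniteType f] [QuasiCompact f] (hW : Scheme.IsRegular W) (g₀ : W.functionField)
    (hg₀ : ∀ c : W.functionField, c ^ p ≠ g₀) (hdim : topologicalKrullDim W ≤ 2)
    (V : Scheme.{0}) (π : V ⟶ W) [IsIntegral V] [IsDominant π] [IsProper π]
    (hπbir : IsBirational π) (hVreg : Scheme.IsRegular V)
    (hformal : ∀ v : V, IsClosed ({v} : Set V) →
        ∃ c : Fin p → W.functionField, (∃ j : Fin p, (j : ℕ) ≠ 0 ∧ c j ≠ 0) ∧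
        ((∃ (d m : ℕ) (hmd : m ≤ d)
            (τ : Fin d → AdicCompletion (maximalIdeal (V.presheaf.stalk v)) (V.presheaf.stalk v))
            (a : Fin m → ℕ)
            (û : AdicCompletion (maximalIdeal (V.presheaf.stalk v)) (V.presheaf.stalk v))
            (s : V.presheaf.stalk v), IsUnit û ∧
            Ideal.span (Set.range τ) =
              (maximalIdeal (V.presheaf.stalk v)).map (algebraMap (V.presheaf.stalk v) (AdicCompletion (maximalIdeal (V.presheaf.stalk v)) (V.presheaf.stalk v))) ∧
            ringKrullDim (V.presheaf.stalk v) = (d : WithBot ℕ∞) ∧ 0 < m ∧ (∀ i, ¬ p ∣ a i) ∧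
            RatFn.functionFieldMap π (∑ j : Fin p, c j ^ p * g₀ ^ (j : ℕ)) =
              algebraMap (V.presheaf.stalk v) V.functionField s ∧
            algebraMap (V.presheaf.stalk v)
              (AdicCompletion (maximalIdeal (V.presheaf.stalk v)) (V.presheaf.stalk v)) s =
              û * ∏ i : Fin m, τ (Fin.castLE hmd i) ^ (a i)) ∨
          (∃ u : V.presheaf.stalk v, IsUnit u ∧
            RatFn.functionFieldMap π (∑ j : Fin p, c j ^ p * g₀ ^ (j : ℕ)) =
              algebraMap (V.presheaf.stalk v) V.functionField u ∧
            ∀ ĉ : AdicCompletion (maximalIdeal (V.presheaf.stalk v)) (V.presheaf.stalk v),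
              algebraMap (V.presheaf.stalk v)
                (AdicCompletion (maximalIdeal (V.presheaf.stalk v)) (V.presheaf.stalk v)) u - ĉ ^ p ∉
                (maximalIdeal (V.presheaf.stalk v)).map (algebraMap (V.presheaf.stalk v) (AdicCompletion (maximalIdeal (V.presheaf.stalk v)) (V.presheaf.stalk v)))) ∨
          (∃ (s : V.presheaf.stalk v)
            (ĉ : AdicCompletion (maximalIdeal (V.presheaf.stalk v)) (V.presheaf.stalk v)),
            RatFn.functionFieldMap π (∑ j : Fin p, c j ^ p * g₀ ^ (j : ℕ)) =
              algebraMap (V.presheaf.stalk v) V.functionField s ∧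
            algebraMap (V.presheaf.stalk v)
                (AdicCompletion (maximalIdeal (V.presheaf.stalk v)) (V.presheaf.stalk v)) s - ĉ ^ p ∈
              (maximalIdeal (V.presheaf.stalk v)).map (algebraMap (V.presheaf.stalk v) (AdicCompletion (maximalIdeal (V.presheaf.stalk v)) (V.presheaf.stalk v))) ∧
            algebraMap (V.presheaf.stalk v)
                (AdicCompletion (maximalIdeal (V.presheaf.stalk v)) (V.presheaf.stalk v)) s - ĉ ^ p ∉
              (maximalIdeal (V.presheaf.stalk v)).map (algebraMap (V.presheaf.stalk v) (AdicCompletion (maximalIdeal (V.presheaf.stalk v)) (V.presheaf.stalk v))) ^ 2))) :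
    ∃ (V' : Scheme.{0}) (π' : V' ⟶ W) (_ : IsIntegral V') (_ : IsDominant π'),
      IsProper π' ∧ IsBirational π' ∧ Scheme.IsRegular V' ∧
      ∀ v : V', IsClosed ({v} : Set V') →
        ∃ c : Fin p → W.functionField, (∃ j : Fin p, (j : ℕ) ≠ 0 ∧ c j ≠ 0) ∧
        ((∃ (d m : ℕ) (hmd : m ≤ d) (t : Fin d → V'.presheaf.stalk v) (a : Fin m → ℕ)
            (û : AdicCompletion (maximalIdeal (V'.presheaf.stalk v)) (V'.presheaf.stalk v))
            (s : V'.presheaf.stalk v), IsUnit û ∧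
            Ideal.span (Set.range t) = maximalIdeal (V'.presheaf.stalk v) ∧
            ringKrullDim (V'.presheaf.stalk v) = (d : WithBot ℕ∞) ∧ 0 < m ∧ (∀ i, ¬ p ∣ a i) ∧
            RatFn.functionFieldMap π' (∑ j : Fin p, c j ^ p * g₀ ^ (j : ℕ)) =
              algebraMap (V'.presheaf.stalk v) V'.functionField s ∧
            algebraMap (V'.presheaf.stalk v)
              (AdicCompletion (maximalIdeal (V'.presheaf.stalk v)) (V'.presheaf.stalk v)) s =
              û * ∏ i : Fin m, algebraMap (V'.presheaf.stalk v)
                (AdicCompletion (maximalIdeal (V'.presheaf.stalk v)) (V'.presheaf.stalk v))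
                (t (Fin.castLE hmd i)) ^ (a i)) ∨
          (∃ u : V'.presheaf.stalk v, IsUnit u ∧
            RatFn.functionFieldMap π' (∑ j : Fin p, c j ^ p * g₀ ^ (j : ℕ)) =
              algebraMap (V'.presheaf.stalk v) V'.functionField u ∧
            ∀ ĉ : AdicCompletion (maximalIdeal (V'.presheaf.stalk v)) (V'.presheaf.stalk v),
              algebraMap (V'.presheaf.stalk v)
                (AdicCompletion (maximalIdeal (V'.presheaf.stalk v)) (V'.presheaf.stalk v)) u - ĉ ^ p ∉
                (maximalIdeal (V'.presheaf.stalk v)).map (algebraMap (V'.presheaf.stalk v) (AdicCompletion (maximalIdeal (V'.presheaf.stalk v)) (V'.presheaf.stalk v)))) ∨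
          (∃ (s : V'.presheaf.stalk v)
            (ĉ : AdicCompletion (maximalIdeal (V'.presheaf.stalk v)) (V'.presheaf.stalk v)),
            RatFn.functionFieldMap π' (∑ j : Fin p, c j ^ p * g₀ ^ (j : ℕ)) =
              algebraMap (V'.presheaf.stalk v) V'.functionField s ∧
            algebraMap (V'.presheaf.stalk v)
                (AdicCompletion (maximalIdeal (V'.presheaf.stalk v)) (V'.presheaf.stalk v)) s - ĉ ^ p ∈
              (maximalIdeal (V'.presheaf.stalk v)).map (algebraMap (V'.presheaf.stalk v) (AdicCompletion (maximalIdeal (V'.presheaf.stalk v)) (V'.presheaf.stalk v))) ∧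
            algebraMap (V'.presheaf.stalk v)
                (AdicCompletion (maximalIdeal (V'.presheaf.stalk v)) (V'.presheaf.stalk v)) s - ĉ ^ p ∉
              (maximalIdeal (V'.presheaf.stalk v)).map (algebraMap (V'.presheaf.stalk v) (AdicCompletion (maximalIdeal (V'.presheaf.stalk v)) (V'.presheaf.stalk v))) ^ 2)) := by
  classical
  -- `hW` and `hg₀` belong to the registered signature; the assembly does not use them
  have _ := hW; have _ := hg₀
  -- `dim V = dim W ≤ 2`
  have halt : IsAlteration π := by
    obtain ⟨U, hU, -, hiso⟩ := hπbir
    exact ⟨inferInstance, inferInstance, inferInstance, U, hU.nonempty, inferInstance⟩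
  have hdimV : topologicalKrullDim V ≤ 2 := (halt.topologicalKrullDim_eq f).trans_le hdim
  -- the candidate representatives, indexed by the non-trivial coefficient vectors
  obtain ⟨x, hx⟩ : ∃ x : {c : Fin p → W.functionField // ∃ j : Fin p, (j : ℕ) ≠ 0 ∧ c j ≠ 0} →
      V.functionField,
      ∀ i, x i = RatFn.functionFieldMap π (∑ j : Fin p, i.1 j ^ p * g₀ ^ (j : ℕ)) :=
    ⟨_, fun _ => rfl⟩
  -- the loosely clean model: at closed points, formally clean is Zariski clean or nodal
  obtain ⟨V', ρ, hV'int, hρdom, hρprop, hρbir, hV'reg, hpt⟩ :=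
    exists_looseCleanModel_of_looseOrNodal p hp k V (π ≫ f) hVreg x (fun v hv => by
      obtain ⟨c, hc, hF⟩ := hformal v hv
      haveI : IsRegularLocalRing (V.presheaf.stalk v) := hVreg v
      haveI : CharP (V.presheaf.stalk v) p := charP_stalk V (π ≫ f) v
      have hd2 : ringKrullDim (V.presheaf.stalk v) ≤ 2 := ringKrullDim_stalk_le_two v hdimV
      refine ⟨⟨c, hc⟩, ?_⟩
      rw [hx]
      exact stub_cleanOrNodalOfFormal p hp hd2
        (fun f₁ hf₁ => stub_formalFibreReducedStalk k V (π ≫ f) v hd2 f₁ hf₁) _ hF)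
  haveI := hV'int; haveI := hρdom; haveI := hρprop
  -- `π^♯ : K(W) ≅ K(V)`
  have hbij : Function.Bijective (RatFn.functionFieldMap π) := by
    obtain ⟨U, hU, hU', hiso⟩ := hπbir
    haveI := hiso
    exact RatFn.functionFieldMap_bijective_of_isIso_morphismRestrict π U hU hU'
  let eqv : W.functionField ≃+* V.functionField := RingEquiv.ofBijective _ hbij
  have heqv : ∀ z, eqv z = RatFn.functionFieldMap π z := fun _ => rfl
  refine ⟨V', ρ ≫ π, hV'int, inferInstance, inferInstance, hρbir.comp hπbir, hV'reg,
    fun v' hv' => ?_⟩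
  obtain ⟨i, h, hh, hloose⟩ := hpt v' hv'
  obtain ⟨j, hj, hcj⟩ := i.2
  -- read the twist `h = π^♯ e` in `K(W)`
  have he : RatFn.functionFieldMap π (eqv.symm h) = h := by
    rw [← heqv, RingEquiv.apply_symm_apply]
  have he0 : eqv.symm h ≠ 0 := (map_ne_zero eqv.symm).mpr hh
  obtain ⟨c', hc'⟩ : ∃ c' : Fin p → W.functionField, ∀ l, c' l = eqv.symm h * i.1 l :=
    ⟨_, fun _ => rfl⟩
  have hsum : ∑ l : Fin p, c' l ^ p * g₀ ^ (l : ℕ) =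
      eqv.symm h ^ p * ∑ l : Fin p, i.1 l ^ p * g₀ ^ (l : ℕ) := by
    rw [Finset.mul_sum]
    exact Finset.sum_congr rfl fun l _ => by rw [hc', mul_pow, mul_assoc]
  have heq : RatFn.functionFieldMap (ρ ≫ π) (∑ l : Fin p, c' l ^ p * g₀ ^ (l : ℕ)) =
      RatFn.functionFieldMap ρ (h ^ p * x i) := by
    rw [hsum, RatFn.functionFieldMap_comp π ρ, RingHom.comp_apply, map_mul, map_pow, he, hx]
  refine ⟨c', ⟨j, hj, by rw [hc']; exact mul_ne_zero he0 hcj⟩, ?_⟩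
  haveI : IsRegularLocalRing (V'.presheaf.stalk v') := hV'reg v'
  haveI : CharP (V'.presheaf.stalk v') p := charP_stalk V' ((ρ ≫ π) ≫ f) v'
  rw [heq]
  exact (looseClean_iff_algebraizedFormalClean p hp _).mp hloose

end Summit.ResolutionOfSingularities.ResolutionOfSingularities.Theorems.RadicialJung.CleanModels

end
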